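import Literature.Probability.RandomPlanarGeometry.SAWBridgeSpanGF
import Literature.Probability.RandomPlanarGeometry.SAWBridgeRenewalEquation
import Literature.Probability.RandomPlanarGeometry.SAWKestenRelation
import Literature.Probability.Process.EricksonRenewalBounds
import Literature.Probability.Process.RenewalTheorem
import Mathlib.Analysis.SpecialFunctions.Pow.Real
import HarnessLib

/-!
# Kesten's bridge renewal graded by SPAN on `ℤ^d`: the span renewal equation, the span law of an
# irreducible bridge, the span-Erickson sandwich, and the door `u_A → 0 ⟺ E_I[span] = ∞`

Topic `Literature/Probability/RandomPlanarGeometry` (continues `SAWBridgeRenewalEquation.lean` — the unique factorisation of a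
bridge into its first irreducible piece and a bridge, `bridgeCount_eq_sum_Icc` = Madras–Slade (4.2.2) —, `SAWKestenRelation.lean`
— Kesten's relation (4.2.4) `Σ_n λ_n μ^{-n} = 1` —, `SAWBridgeSpanGF.lean` — bridges of span `A`, `brSpan`, and Hutchcroft's
`V_M(z_c;A) ≤ 1`, `brGF_critical_le_one` — and the abstract renewal files `Process/EricksonRenewalBounds.lean` (Erickson 1973,
Lemma 1) and `Process/RenewalTheorem.lean` (Madras–Slade Theorem 4.2.2 (b))).

Sources.  N. Madras, G. Slade, *The Self-Avoiding Walk* (1993), §4.2: (4.2.2) `b_N = Σ_s λ_s b_{N−s} + δ_{N,0}` (p. 90), (4.2.4)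
`Σ_N λ_N μ^{-N} = 1` and (4.2.5) the renewal equation for `b_N μ^{-N}` (p. 91), Theorem 4.2.2 (b) (renewal theorem); Corollary
3.1.8 / T. Hutchcroft (2018), Lemma 2.3 (`Σ_n b_{n,A} z_cⁿ ≤ 1`); K. B. Erickson, Trans. AMS 185 (1973), Lemma 1 (the sandwich
`x/E min(χ,x) ≤ H[0,x] ≤ 2x/E min(χ,x)`); H. Duminil-Copin, A. Hammond, CMP 324 (2013), Lemma 2.2 (Kesten's measure
`P_I(γ) = μ^{-|γ|}` on irreducible bridges).  The SPAN grading of this renewal structure is printed for the HEXAGONAL lattice in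
N. R. Beaton, M. Bousquet-Mélou, J. de Gier, H. Duminil-Copin, A. J. Guttmann, CMP 326 (2014), Appendix, Lemma 11 (arXiv:1109.0358
p. 11): "As `T → ∞`, `B_T(x_c,1) → 1/E_iSAB(height(γ))`. Proof. The result follows from standard renewal theory. We can for instance
apply [MadrasSlade93] to the sequence `f_T := Σ_{γ ∈ iSAB : height(γ) = T} x_c^{|γ|}`" (their `f_T` is `spanLaw`, their `B_T` is
`spanGF`; stated without the sandwich) [cite: BeatonBousquetMelouDeGierDuminilCopinGuttmann2014, Lemma 11]; the present file types
it on `ℤ^d` with the Erickson sandwich (a) and the Cesàro forms (d)/(d′), which were not located in print — lane «pcv-sawmu» route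
R61 «SPAN-ERICKSON» (a-idea-1, ROUTES-G12 §R61; statements `stub_R61_spanRenewal`, `stub_R61_spanLaw_hasSum`, `stub_R61_spanErickson`,
`stub_R61_door_iff`, `stub_R61_meanSpan_of_cesaro` of Sketch_G12 verbatim in shape; searches there and lit-1 cell (γ), 2026-08-22).
Whether `u_A → 0` (equivalently `E_I[span] = ∞`, theorem (b)) HOLDS is proved only on the hexagonal lattice
[cite: BeatonBousquetMelouDeGierDuminilCopinGuttmann2014, Theorem 10] and is open on `ℤ^d`, `d = 2, 3, 4`.

Write `u_A := Σ_m b_{m,A} μ^{-m}` (`spanGF`, the full critical span-`A` bridge generating function — the `ℤ^d` analogue of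
Duminil-Copin–Smirnov's `B_T(x_c)`), `f_A := Σ_n #{irreducible n-bridges of span A} μ^{-n}` (`spanLaw`), `U^{sp}_A := Σ_{B≤A} u_B`
(`spanMass`), `P_I(span > j) := 1 − Σ_{B≤j} f_B` (`irrSpanTail`), `m^{sp}_A := Σ_{j≤A} P_I(span > j) = E_I[min(span, A+1)]`.

## What is here (namespace `Literature.Probability.RandomPlanarGeometry.SAW.Zd`; all proved, axioms standard)

* `card_brSpan_eq_sum` — the factorisation (4.2.2) GRADED BY SPAN: `b_{n,A} = Σ_{s=1}^{n} Σ_{B≤A} λ_{s,B} b_{n−s,A−B}`;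
* `spanGF_summable_le_one` — `u_A ≤ 1` and summability (Hutchcroft's Lemma 2.3 in the limit `M → ∞`);
* **`spanRenewal`** (S1) — `u_0 = 1`, `f_0 = 0`, `u_A = Σ_{B≤A} f_B u_{A−B}` (`A ≥ 1`);
* **`spanLaw_hasSum`** (S2) — `f ≥ 0` and `Σ_A f_A = 1` (Kesten's relation regrouped by span);
* **`spanErickson`** (a) — `A + 1 ≤ U^{sp}_A · m^{sp}_A ≤ 2A + 1` for every `A`, every `d ≥ 1`;
* **`spanGF_tendsto_zero_iff`** (b) — `u_A → 0 ⟺ ¬ Summable (A f_A)` (`E_I[span] = ∞`), by the renewal theorem (aperiodic: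
  `f_1 = u_1 > 0`);
* **`meanSpan_of_cesaro`** (d) — `U^{sp}_A ≤ C (A+1)^{1−η}` ⇒ `m^{sp}_A ≥ (A+1)^η / C`; `tendsto_brGF_spanGF`,
  `spanMass_le_of_sum_brGF_le`, **`meanSpan_of_cesaroRate`** (d′) — the same from the truncated hypothesis
  `Σ_{B≤A} V_M(z_c;B) ≤ C (A+1)^{1−η}` (all `M`) of the lane's Cesàro engine.
-/

noncomputable section

open Finset Filter Topology Literature.Probability.LatticeModels Literature.Probability.Percolation SimpleGraph
open scoped BigOperators

namespace Literature.Probability.RandomPlanarGeometry.SAW.Zd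

variable (d : ℕ) [NeZero d]

open Classical in
/-- Irreducible `n`-step bridges of span `A` (endpoint level `ω n 0 = A`); `λ_{n,A}` counts them.
[cite: DuminilCopinHammond2013, §2.2; MadrasSlade1993, Definition 4.2.1 and Definition 3.1.3] -/
def irrBrSpan (n : ℕ) (A : ℤ) : Finset (ℕ → Site d) :=
  (irreducibleBridges d n).filter fun ω => ω n 0 = A

/-- `u_A := Σ_m b_{m,A} μ^{-m}` — the FULL critical span-`A` bridge generating function (`= lim_M V_M(z_c;A)`, each truncation
`≤ 1` by Hutchcroft's Lemma 2.3 = `brGF_critical_le_one`); the `ℤ^d` analogue of Duminil-Copin–Smirnov's `B_T(x_c)`.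
[cite: Hutchcroft2018HammersleyWelsh, Lemma 2.3; MadrasSlade1993, Corollary 3.1.8] -/
def spanGF (A : ℕ) : ℝ :=
  ∑' m : ℕ, ((brSpan d m (A : ℤ)).card : ℝ) / connectiveConstant d ^ m

/-- `f_A := Σ_n λ_{n,A} μ^{-n}` — the SPAN LAW of a Kesten-irreducible bridge (`P_I(γ) = μ^{-|γ|}`; `Σ_A f_A = 1` is Kesten's
relation (4.2.4) regrouped by span; `f_0 = 0`, `f_1 = u_1`). [cite: DuminilCopinHammond2013, Lemma 2.2; MadrasSlade1993, §4.2, eq. (4.2.4)] -/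
def spanLaw (A : ℕ) : ℝ :=
  ∑' n : ℕ, ((irrBrSpan d n (A : ℤ)).card : ℝ) / connectiveConstant d ^ n

/-- `U^{sp}_A := Σ_{B ≤ A} u_B` — the critical bridge mass up to SPAN `A` (`u_0 = 1`).
[cite: MadrasSlade1993, §4.2 (the renewal measure of (4.2.5)); Erickson1973, Lemma 1 (`H[0,x]`)] -/
def spanMass (A : ℕ) : ℝ := ∑ B ∈ range (A + 1), spanGF d B

/-- `P_I(span > j) = 1 − Σ_{B ≤ j} f_B`, the span tail of Kesten's irreducible-bridge law; `m^{sp}_A := Σ_{j ≤ A} P_I(span > j)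
= E_I[min(span, A+1)]` is the truncated mean span. [cite: DuminilCopinHammond2013, Lemma 2.2; Erickson1973, Lemma 1 (`E min(χ,x)`)] -/
def irrSpanTail (j : ℕ) : ℝ := 1 - ∑ B ∈ range (j + 1), spanLaw d B

variable {d}

/-! ### §1. Bridges graded by span: membership, small cases -/

/-- Membership in `irrBrSpan`. [cite: DuminilCopinHammond2013, §2.2] -/
theorem mem_irrBrSpan {n : ℕ} {A : ℤ} {ω : ℕ → Site d} :
    ω ∈ irrBrSpan d n A ↔ ω ∈ irreducibleBridges d n ∧ ω n 0 = A := by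
  classical
  exact Finset.mem_filter

/-- A bridge of positive length has positive span. [cite: MadrasSlade1993, Definition 1.2.4] -/
theorem one_le_apply_zero_of_mem_bridges {n : ℕ} {ω : ℕ → Site d} (hω : ω ∈ bridges d n) (hn : 1 ≤ n) :
    1 ≤ ω n 0 := by
  obtain ⟨hs, hb⟩ := mem_bridges.1 hω
  have h0 : ω 0 0 = 0 := by rw [(mem_saws.1 hs).1]; rfl
  have h := (hb n hn le_rfl).1
  rw [h0] at h
  omega

/-- The only bridge of span `0` is the `0`-step walk: `b_{0,0} = 1`. [cite: MadrasSlade1993, §4.2, eq. (4.2.2) (`δ_{N,0}`)] -/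
theorem card_brSpan_zero_zero : (brSpan d 0 0).card = 1 := by
  classical
  have : brSpan d 0 0 = {0} := by
    ext ω
    rw [mem_brSpan, bridges_zero, Finset.mem_singleton]
    constructor
    · exact fun h => h.1
    · rintro rfl; exact ⟨rfl, rfl⟩
  rw [this, Finset.card_singleton]

/-- `b_{0,A} = 0` for `A ≠ 0`. [cite: MadrasSlade1993, §4.2, eq. (4.2.2) (`δ_{N,0}`)] -/
theorem card_brSpan_zero_of_ne {A : ℤ} (hA : A ≠ 0) : (brSpan d 0 A).card = 0 := by
  classical
  rw [Finset.card_eq_zero, Finset.eq_empty_iff_forall_notMem]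
  intro ω hω
  obtain ⟨hb, hωA⟩ := mem_brSpan.1 hω
  rw [bridges_zero, Finset.mem_singleton] at hb
  subst hb
  exact hA (by rw [← hωA]; rfl)

/-- `b_{n,A} = 0` for `n ≥ 1` and `A ≤ 0`. [cite: MadrasSlade1993, Definition 1.2.4] -/
theorem card_brSpan_of_nonpos {n : ℕ} (hn : 1 ≤ n) {A : ℤ} (hA : A ≤ 0) : (brSpan d n A).card = 0 := by
  classical
  rw [Finset.card_eq_zero, Finset.eq_empty_iff_forall_notMem]
  intro ω hω
  obtain ⟨hb, hωA⟩ := mem_brSpan.1 hω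
  have := one_le_apply_zero_of_mem_bridges hb hn
  omega

/-- `λ_{n,A} = 0` for `A ≤ 0` (irreducible bridges have length `≥ 1`, hence span `≥ 1`).
[cite: DuminilCopinHammond2013, §2.2] -/
theorem card_irrBrSpan_of_nonpos (n : ℕ) {A : ℤ} (hA : A ≤ 0) : (irrBrSpan d n A).card = 0 := by
  classical
  rw [Finset.card_eq_zero, Finset.eq_empty_iff_forall_notMem]
  intro ω hω
  obtain ⟨hirr, hωA⟩ := mem_irrBrSpan.1 hω
  obtain ⟨hb, hI⟩ := mem_irreducibleBridges.1 hirr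
  have := one_le_apply_zero_of_mem_bridges hb hI.1
  omega

/-- `λ_{0,A} = 0`. [cite: DuminilCopinHammond2013, §2.2] -/
theorem card_irrBrSpan_zero (A : ℤ) : (irrBrSpan d 0 A).card = 0 := by
  classical
  rw [Finset.card_eq_zero, Finset.eq_empty_iff_forall_notMem]
  intro ω hω
  obtain ⟨hirr, -⟩ := mem_irrBrSpan.1 hω
  exact absurd (mem_irreducibleBridges.1 hirr).2.1 (by omega)

/-- `λ_{n,A} ≤ b_{n,A}`. [cite: DuminilCopinHammond2013, §2.2] -/
theorem card_irrBrSpan_le (n : ℕ) (A : ℤ) : (irrBrSpan d n A).card ≤ (brSpan d n A).card := by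
  classical
  refine Finset.card_le_card fun ω hω => ?_
  obtain ⟨hirr, hωA⟩ := mem_irrBrSpan.1 hω
  exact mem_brSpan.2 ⟨irreducibleBridges_subset_bridges n hirr, hωA⟩

/-- The span of an `n`-step bridge is at most `n`: `b_{n,A} = 0` for `A > n`. [cite: MadrasSlade1993, Definition 1.2.4] -/
theorem card_brSpan_of_lt {n : ℕ} {A : ℤ} (hA : (n : ℤ) < A) : (brSpan d n A).card = 0 := by
  classical
  rw [Finset.card_eq_zero, Finset.eq_empty_iff_forall_notMem]
  intro ω hω
  obtain ⟨hb, hωA⟩ := mem_brSpan.1 hω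
  obtain ⟨hs, -⟩ := mem_bridges.1 hb
  have h := abs_apply_le_of_adj (mem_saws.1 hs).1 (mem_saws.1 hs).2.2.1 n le_rfl 0
  rw [hωA] at h
  have := (abs_le.1 h).2
  omega

/-! ### §2. The factorisation (4.2.2) graded by span -/

/-- **Madras–Slade (4.2.2) graded by span**: for `n ≥ 1`, `b_{n,A} = Σ_{s=1}^{n} Σ_{B=0}^{A} λ_{s,B} · b_{n−s,A−B}` — every bridge
is, in exactly one way, an irreducible bridge (up to its first renewal time) followed by a bridge, and spans ADD under this
concatenation. [cite: MadrasSlade1993, §4.2, eq. (4.2.2) (p. 90); Hutchcroft2018HammersleyWelsh, §2.1] -/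
theorem card_brSpan_eq_sum {n : ℕ} (hn : 1 ≤ n) (A : ℕ) :
    (brSpan d n (A : ℤ)).card =
      ∑ s ∈ Icc 1 n, ∑ B ∈ range (A + 1),
        (irrBrSpan d s (B : ℤ)).card * (brSpan d (n - s) ((A - B : ℕ) : ℤ)).card := by
  classical
  have hcard : ((Icc 1 n ×ˢ range (A + 1)).sigma fun p =>
      irrBrSpan d p.1 (p.2 : ℤ) ×ˢ brSpan d (n - p.1) ((A - p.2 : ℕ) : ℤ)).card =
      ∑ s ∈ Icc 1 n, ∑ B ∈ range (A + 1),
        (irrBrSpan d s (B : ℤ)).card * (brSpan d (n - s) ((A - B : ℕ) : ℤ)).card := by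
    rw [card_sigma, sum_product]
    simp_rw [card_product]
  rw [← hcard]
  symm
  refine card_nbij (fun q => concatWalk q.1.1 q.2.1 q.2.2) ?_ ?_ ?_
  · -- the gluing lands in the `n`-step bridges of span `A`
    rintro ⟨⟨s, B⟩, η, τ⟩ hq
    simp only [mem_coe, mem_sigma, mem_product, mem_Icc, mem_range] at hq
    obtain ⟨⟨⟨-, hsn⟩, hB⟩, hη, hτ⟩ := hq
    obtain ⟨hηirr, hηB⟩ := mem_irrBrSpan.1 hη
    have hη' : η ∈ brSpan d s (B : ℤ) := mem_brSpan.2 ⟨irreducibleBridges_subset_bridges s hηirr, hηB⟩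
    have h := concatWalk_mem_brSpan hη' hτ
    have e1 : s + (n - s) = n := by omega
    have e2 : (B : ℤ) + ((A - B : ℕ) : ℤ) = (A : ℤ) := by
      have hBA : B ≤ A := by omega
      rw [Nat.cast_sub hBA]; ring
    rw [e1, e2] at h
    simpa using h
  · -- injectivity: the gluing time is the first renewal time, the pieces and then `B` are determined
    rintro ⟨⟨s, B⟩, η, τ⟩ hq ⟨⟨s', B'⟩, η', τ'⟩ hq' h
    simp only [mem_coe, mem_sigma, mem_product, mem_Icc, mem_range] at hq hq'
    obtain ⟨⟨⟨hs1, hsn⟩, -⟩, hη, hτ⟩ := hq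
    obtain ⟨⟨⟨hs1', hsn'⟩, -⟩, hη', hτ'⟩ := hq'
    obtain ⟨hηirr, hηB⟩ := mem_irrBrSpan.1 hη
    obtain ⟨hηirr', hηB'⟩ := mem_irrBrSpan.1 hη'
    have hηb := irreducibleBridges_subset_bridges s hηirr
    have hηb' := irreducibleBridges_subset_bridges s' hηirr'
    have hτb := (mem_brSpan.1 hτ).1
    have hτb' := (mem_brSpan.1 hτ').1
    dsimp only at h
    have hren := isRenewalTime_concatWalk hsn hηb hτb
    have hren' := isRenewalTime_concatWalk hsn' hηb' hτb'
    obtain rfl : s = s' := by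
      by_contra hne
      rcases lt_or_gt_of_ne hne with hlt | hlt
      · rw [h] at hren
        exact not_isRenewalTime_concatWalk_of_lt hsn' hηirr' hs1 hlt hren
      · rw [← h] at hren'
        exact not_isRenewalTime_concatWalk_of_lt hsn hηirr hs1' hlt hren'
    obtain ⟨h1, h2⟩ := concatWalk_injective_pieces (mem_bridges.1 hηb).1 (mem_bridges.1 hτb).1
      (mem_bridges.1 hηb').1 (mem_bridges.1 hτb').1 h
    subst h1 h2
    obtain rfl : B = B' := by exact_mod_cast hηB.symm.trans hηB'
    rfl
  · -- surjectivity: split a bridge of span `A` at its first renewal time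
    intro ω hω
    rw [mem_coe] at hω
    obtain ⟨hωb, hωA⟩ := mem_brSpan.1 hω
    obtain ⟨s, hs1, hs, hmin⟩ := exists_first_renewalTime hn (mem_bridges.1 hωb).2
    have hsn : s ≤ n := hs.1
    obtain ⟨h0s, hsA⟩ := apply_zero_mem_Icc_of_mem_bridges hωb hsn
    rw [hωA] at hsA
    set B : ℕ := (ω s 0).toNat with hB
    have hBz : (B : ℤ) = ω s 0 := Int.toNat_of_nonneg h0s
    have hBA : B ≤ A := by omega
    refine ⟨⟨⟨s, B⟩, fun i => ω (min i s), fun j => ω (s + j) - ω s⟩, ?_, concatWalk_head_tail ω⟩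
    simp only [mem_coe, mem_sigma, mem_product, mem_Icc, mem_range]
    refine ⟨⟨⟨hs1, hsn⟩, by omega⟩, ?_, ?_⟩
    · exact mem_irrBrSpan.2 ⟨headWalk_mem_irreducibleBridges hωb hs1 hs hmin, by simp [hBz]⟩
    · refine mem_brSpan.2 ⟨tailShift_mem_bridges hωb hs, ?_⟩
      have e : s + (n - s) = n := by omega
      simp only [Pi.sub_apply, e, hωA, Nat.cast_sub hBA, ← hBz]

/-! ### §3. Summability, `u_A ≤ 1`, and the values `u_0 = 1`, `f_0 = 0` -/

/-- The partial sums of `u_A` are the truncations `V_M(z_c;A)`. [cite: MadrasSlade1993, §3.1, proof of Corollary 3.1.8] -/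
theorem sum_range_brSpan_div_pow (M : ℕ) (A : ℤ) :
    ∑ m ∈ range (M + 1), ((brSpan d m A).card : ℝ) / connectiveConstant d ^ m =
      brGF d M (connectiveConstant d)⁻¹ A := by
  unfold brGF
  refine sum_congr rfl fun m _ => ?_
  rw [inv_pow, div_eq_mul_inv]

/-- (S0) `u_A = Σ_m b_{m,A} μ^{-m}` converges and `u_A ≤ 1` (every truncation is `≤ 1`, Hutchcroft's Lemma 2.3).
[cite: Hutchcroft2018HammersleyWelsh, Lemma 2.3; MadrasSlade1993, Corollary 3.1.8] -/
theorem spanGF_summable_le_one (A : ℕ) :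
    Summable (fun m : ℕ => ((brSpan d m (A : ℤ)).card : ℝ) / connectiveConstant d ^ m) ∧ spanGF d A ≤ 1 := by
  have hμ := connectiveConstant_pos d
  have hnn : ∀ m, 0 ≤ ((brSpan d m (A : ℤ)).card : ℝ) / connectiveConstant d ^ m := fun m => by positivity
  have hle : ∀ M, ∑ m ∈ range M, ((brSpan d m (A : ℤ)).card : ℝ) / connectiveConstant d ^ m ≤ 1 := by
    intro M
    cases M with
    | zero => simp
    | succ M => rw [sum_range_brSpan_div_pow]; exact brGF_critical_le_one M _
  exact ⟨summable_of_sum_range_le hnn hle, Real.tsum_le_of_sum_range_le hnn hle⟩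

/-- `f_A`'s series converges (`λ_{n,A} ≤ b_{n,A}`). [cite: DuminilCopinHammond2013, Lemma 2.2] -/
theorem summable_irrBrSpan_div_pow (A : ℕ) :
    Summable (fun n : ℕ => ((irrBrSpan d n (A : ℤ)).card : ℝ) / connectiveConstant d ^ n) := by
  have hμ := connectiveConstant_pos d
  refine (spanGF_summable_le_one (d := d) A).1.of_nonneg_of_le (fun n => by positivity) fun n => ?_
  exact div_le_div_of_nonneg_right (by exact_mod_cast card_irrBrSpan_le n _) (pow_pos hμ n).le

/-- `u_A ≥ 0`. [cite: Hutchcroft2018HammersleyWelsh, Lemma 2.3] -/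
theorem spanGF_nonneg (A : ℕ) : 0 ≤ spanGF d A := by
  have hμ := connectiveConstant_pos d
  exact tsum_nonneg fun m => by positivity

/-- `f_A ≥ 0`. [cite: DuminilCopinHammond2013, Lemma 2.2] -/
theorem spanLaw_nonneg (A : ℕ) : 0 ≤ spanLaw d A := by
  have hμ := connectiveConstant_pos d
  exact tsum_nonneg fun n => by positivity

/-- `f_A ≤ u_A`. [cite: DuminilCopinHammond2013, Lemma 2.2] -/
theorem spanLaw_le_spanGF (A : ℕ) : spanLaw d A ≤ spanGF d A := by
  have hμ := connectiveConstant_pos d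
  refine (summable_irrBrSpan_div_pow (d := d) A).tsum_le_tsum (fun n => ?_) (spanGF_summable_le_one (d := d) A).1
  exact div_le_div_of_nonneg_right (by exact_mod_cast card_irrBrSpan_le n _) (pow_pos hμ n).le

/-- `u_0 = 1` (the `0`-step walk is the only bridge of span `0`). [cite: MadrasSlade1993, §4.2, eq. (4.2.2) (`δ_{N,0}`)] -/
theorem spanGF_zero : spanGF d 0 = 1 := by
  unfold spanGF
  rw [tsum_eq_single 0 fun m hm => ?_]
  · rw [Nat.cast_zero, card_brSpan_zero_zero]; simp
  · rw [Nat.cast_zero, card_brSpan_of_nonpos (Nat.one_le_iff_ne_zero.2 hm) le_rfl]; simp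

/-- `f_0 = 0`. [cite: DuminilCopinHammond2013, §2.2] -/
theorem spanLaw_zero : spanLaw d 0 = 0 := by
  unfold spanLaw
  simp [card_irrBrSpan_of_nonpos]

/-! ### §4. (S1) The span renewal equation -/

/-- The Cauchy-product term of `f_B · u_C` at total length `m`: `Σ_{s ≤ m} λ_{s,B} μ^{-s} · b_{m−s,C} μ^{-(m−s)} = μ^{-m} Σ_{s ≤ m} λ_{s,B}
b_{m−s,C}`. [cite: MadrasSlade1993, §4.2, eq. (4.2.5) (proof)] -/
private theorem cauchy_term (m : ℕ) (B : ℤ) (C : ℤ) :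
    ∑ s ∈ range (m + 1), ((irrBrSpan d s B).card : ℝ) / connectiveConstant d ^ s *
        (((brSpan d (m - s) C).card : ℝ) / connectiveConstant d ^ (m - s)) =
      (∑ s ∈ range (m + 1), ((irrBrSpan d s B).card : ℝ) * (brSpan d (m - s) C).card) /
        connectiveConstant d ^ m := by
  have hμ := connectiveConstant_pos d
  rw [sum_div]
  refine sum_congr rfl fun s hs => ?_
  have hsm : s ≤ m := Nat.lt_succ_iff.1 (mem_range.1 hs)
  rw [div_mul_div_comm, ← pow_add, Nat.add_sub_cancel' hsm]

/-- **(S1) The SPAN RENEWAL EQUATION**: `u_0 = 1`, `f_0 = 0`, and `u_A = Σ_{B=0}^{A} f_B · u_{A−B}` for `A ≥ 1` — the unique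
factorisation of a bridge into (first irreducible piece) · (bridge), graded by span instead of length (`card_brSpan_eq_sum`),
summed against `μ^{-length}` (Cauchy product of absolutely convergent series).
[cite: MadrasSlade1993, §4.2, eqs. (4.2.2), (4.2.5) (pp. 90–91); DuminilCopinHammond2013, Lemma 2.2] -/
theorem spanRenewal :
    spanGF d 0 = 1 ∧ spanLaw d 0 = 0 ∧
      ∀ A : ℕ, 1 ≤ A → spanGF d A = ∑ B ∈ range (A + 1), spanLaw d B * spanGF d (A - B) := by
  refine ⟨spanGF_zero, spanLaw_zero, fun A hA => ?_⟩
  have hμ := connectiveConstant_pos d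
  -- notation for the two families of terms
  set a : ℕ → ℕ → ℝ := fun B s => ((irrBrSpan d s (B : ℤ)).card : ℝ) / connectiveConstant d ^ s with ha
  set b : ℕ → ℕ → ℝ := fun C j => ((brSpan d j (C : ℤ)).card : ℝ) / connectiveConstant d ^ j with hb
  have ha0 : ∀ B s, 0 ≤ a B s := fun B s => by rw [ha]; positivity
  have hb0 : ∀ C j, 0 ≤ b C j := fun C j => by rw [hb]; positivity
  have haS : ∀ B, Summable (a B) := fun B => summable_irrBrSpan_div_pow (d := d) B
  have hbS : ∀ C, Summable (b C) := fun C => (spanGF_summable_le_one (d := d) C).1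
  have haN : ∀ B, Summable (fun s => ‖a B s‖) := fun B =>
    (haS B).congr fun s => by rw [Real.norm_of_nonneg (ha0 B s)]
  have hbN : ∀ C, Summable (fun j => ‖b C j‖) := fun C =>
    (hbS C).congr fun j => by rw [Real.norm_of_nonneg (hb0 C j)]
  -- each product is a Cauchy series
  have hprod : ∀ B ∈ range (A + 1), spanLaw d B * spanGF d (A - B) =
      ∑' m : ℕ, ∑ s ∈ range (m + 1), a B s * b (A - B) (m - s) := by
    intro B _
    exact tsum_mul_tsum_eq_tsum_sum_range_of_summable_norm (haN B) (hbN (A - B))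
  have hprodS : ∀ B ∈ range (A + 1), Summable (fun m : ℕ => ∑ s ∈ range (m + 1), a B s * b (A - B) (m - s)) := by
    intro B _
    exact summable_sum_mul_range_of_summable_norm' (haN B) (haS B) (hbN (A - B)) (hbS (A - B))
  rw [sum_congr rfl hprod, ← Summable.tsum_finsetSum hprodS]
  unfold spanGF
  refine tsum_congr fun m => ?_
  -- the coefficient of `μ^{-m}` on both sides
  have hterm : ∀ B ∈ range (A + 1), ∑ s ∈ range (m + 1), a B s * b (A - B) (m - s) =
      (∑ s ∈ range (m + 1), ((irrBrSpan d s (B : ℤ)).card : ℝ) * (brSpan d (m - s) ((A - B : ℕ) : ℤ)).card) /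
        connectiveConstant d ^ m := fun B _ => cauchy_term m _ _
  rw [sum_congr rfl hterm, ← sum_div]
  congr 1
  rcases Nat.eq_zero_or_pos m with rfl | hm
  · -- length `0`: no irreducible piece, and no bridge of span `A ≥ 1`
    have hA0 : ((A : ℕ) : ℤ) ≠ 0 := by exact_mod_cast (show A ≠ 0 by omega)
    rw [card_brSpan_zero_of_ne hA0]
    simp [card_irrBrSpan_zero]
  · rw [card_brSpan_eq_sum hm A, sum_comm]
    push_cast
    refine sum_congr rfl fun B _ => ?_
    -- `Σ_{s ∈ range (m+1)}` versus `Σ_{s ∈ Icc 1 m}`: the `s = 0` term vanishes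
    rw [range_eq_Ico, sum_eq_sum_Ico_succ_bot (show 0 < m + 1 by omega), card_irrBrSpan_zero]
    simp only [Nat.cast_zero, zero_mul, zero_add]
    rw [Finset.Ico_add_one_right_eq_Icc]

/-! ### §5. (S2) The span law of an irreducible bridge is a probability law -/

/-- The span of an irreducible `n`-bridge lies in `[0, n]`. [cite: DuminilCopinHammond2013, §2.2; MadrasSlade1993, Definition 1.2.4] -/
theorem span_mem_range_of_mem_irreducibleBridges {n : ℕ} {ω : ℕ → Site d} (hω : ω ∈ irreducibleBridges d n) :
    0 ≤ ω n 0 ∧ (ω n 0).toNat ∈ range (n + 1) := by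
  have hb := irreducibleBridges_subset_bridges n hω
  obtain ⟨hs, -⟩ := mem_bridges.1 hb
  have h0 := (apply_zero_mem_Icc_of_mem_bridges hb le_rfl).1
  have h := abs_apply_le_of_adj (mem_saws.1 hs).1 (mem_saws.1 hs).2.2.1 n le_rfl 0
  refine ⟨h0, mem_range.2 ?_⟩
  have := (abs_le.1 h).2
  omega

/-- The spans partition the irreducible `n`-bridges: `Σ_{A=0}^{n} λ_{n,A} = λ_n`. [cite: DuminilCopinHammond2013, §2.2] -/
theorem sum_card_irrBrSpan (n : ℕ) :
    ∑ A ∈ range (n + 1), (irrBrSpan d n (A : ℤ)).card = irreducibleBridgeCount d n := by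
  classical
  rw [irreducibleBridgeCount, Finset.card_eq_sum_card_fiberwise (f := fun ω : ℕ → Site d => (ω n 0).toNat)
    (t := range (n + 1)) fun ω hω => (span_mem_range_of_mem_irreducibleBridges hω).2]
  refine sum_congr rfl fun A _ => ?_
  unfold irrBrSpan
  congr 1
  ext ω
  simp only [Finset.mem_filter, and_congr_right_iff]
  intro hω
  have h0 := (span_mem_range_of_mem_irreducibleBridges hω).1
  omega

/-- `λ_{n,A} = 0` for `A > n`. [cite: MadrasSlade1993, Definition 1.2.4] -/
theorem card_irrBrSpan_of_lt {n : ℕ} {A : ℤ} (hA : (n : ℤ) < A) : (irrBrSpan d n A).card = 0 :=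
  Nat.eq_zero_of_le_zero ((card_irrBrSpan_le n A).trans (card_brSpan_of_lt hA).le)

/-- For each length `n`, `Σ_A λ_{n,A} μ^{-n} = λ_n μ^{-n}` (a finite sum). [cite: MadrasSlade1993, §4.2, eq. (4.2.4)] -/
theorem tsum_irrBrSpan_div_pow_fiber (n : ℕ) :
    ∑' A : ℕ, ((irrBrSpan d n (A : ℤ)).card : ℝ) / connectiveConstant d ^ n =
      (irreducibleBridgeCount d n : ℝ) / connectiveConstant d ^ n := by
  rw [tsum_eq_sum (s := range (n + 1)) fun A hA => ?_]
  · rw [← sum_div, ← Nat.cast_sum, sum_card_irrBrSpan]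
  · rw [mem_range, not_lt] at hA
    rw [card_irrBrSpan_of_lt (by exact_mod_cast hA)]
    simp

/-- **(S2) Kesten's relation regrouped by span**: the span law `(f_A)` of a Kesten-irreducible bridge is a probability law —
`f_A ≥ 0` and `Σ_A f_A = Σ_n λ_n μ^{-n} = 1` (Madras–Slade (4.2.4), `MadrasSlade1993_eq424_holds`, and Fubini for a
non-negative double series). [cite: MadrasSlade1993, §4.2, eq. (4.2.4) (p. 91); DuminilCopinHammond2013, Lemma 2.2; Kesten1963SAW] -/
theorem spanLaw_hasSum : (∀ A, 0 ≤ spanLaw d A) ∧ HasSum (spanLaw d) 1 := by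
  refine ⟨spanLaw_nonneg, ?_⟩
  have hμ := connectiveConstant_pos d
  set g : ℕ × ℕ → ℝ := fun p => ((irrBrSpan d p.1 (p.2 : ℤ)).card : ℝ) / connectiveConstant d ^ p.1 with hg
  have hg0 : 0 ≤ g := fun p => by simp only [hg]; positivity
  have hfib : ∀ n, Summable fun A => g (n, A) := fun n =>
    summable_of_ne_finset_zero (s := range (n + 1)) fun A hA => by
      rw [mem_range, not_lt] at hA
      simp only [hg]
      rw [card_irrBrSpan_of_lt (by exact_mod_cast hA)]
      simp
  have hval : ∀ n, ∑' A, g (n, A) = (irreducibleBridgeCount d n : ℝ) / connectiveConstant d ^ n :=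
    fun n => tsum_irrBrSpan_div_pow_fiber n
  have hK : HasSum (fun n => (irreducibleBridgeCount d n : ℝ) / connectiveConstant d ^ n) 1 :=
    MadrasSlade1993_eq424_holds d
  have hgS : Summable g := by
    refine (summable_prod_of_nonneg hg0).2 ⟨hfib, ?_⟩
    simp_rw [hval]
    exact hK.summable
  -- the other order of summation
  have hswap : Summable (fun p : ℕ × ℕ => g p.swap) := hgS.prod_symm
  have hg0' : 0 ≤ fun p : ℕ × ℕ => g p.swap := fun p => hg0 p.swap
  have hA : Summable (fun A : ℕ => ∑' n : ℕ, g (n, A)) := ((summable_prod_of_nonneg hg0').1 hswap).2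
  have hcomm : ∑' A : ℕ, ∑' n : ℕ, g (n, A) = ∑' n : ℕ, ∑' A : ℕ, g (n, A) :=
    Summable.tsum_comm (f := fun n A => g (n, A)) hgS
  have htot : ∑' A : ℕ, ∑' n : ℕ, g (n, A) = 1 := by
    rw [hcomm]
    simp_rw [hval]
    exact hK.tsum_eq
  have e : spanLaw d = fun A : ℕ => ∑' n : ℕ, g (n, A) := by
    funext A; rfl
  rw [e]
  exact hA.hasSum_iff.2 htot

/-- The span tails are non-negative: `Σ_{B ≤ j} f_B ≤ 1`. [cite: MadrasSlade1993, §4.2, eq. (4.2.4)] -/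
theorem irrSpanTail_nonneg (j : ℕ) : 0 ≤ irrSpanTail d j := by
  unfold irrSpanTail
  have h := sum_le_hasSum (range (j + 1)) (fun A _ => spanLaw_nonneg (d := d) A) (spanLaw_hasSum (d := d)).2
  linarith

/-- `U^{sp}_A ≥ 1` (`u_0 = 1`, `u ≥ 0`). [cite: Erickson1973, Lemma 1] -/
theorem one_le_spanMass (A : ℕ) : 1 ≤ spanMass d A := by
  unfold spanMass
  rw [← sum_range_add_sum_Ico _ (show 1 ≤ A + 1 by omega), sum_range_one, spanGF_zero]
  have : 0 ≤ ∑ B ∈ Ico 1 (A + 1), spanGF d B := sum_nonneg fun B _ => spanGF_nonneg B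
  linarith

/-! ### §6. (a) The span-Erickson sandwich -/

/-- **(a) SPAN-ERICKSON SANDWICH** (every `ℤ^d`, `d ≥ 1`, unconditional): for every `A`,
`A + 1 ≤ U^{sp}_A · m^{sp}_A ≤ 2A + 1`, where `U^{sp}_A = Σ_{B≤A} u_B` is the critical bridge mass up to span `A` and
`m^{sp}_A = Σ_{j≤A} P_I(span > j) = E_I[min(span, A+1)]` the truncated mean span of a Kesten-irreducible bridge — Erickson's
Lemma 1 (`Renewal.erickson_lower/upper`) pointed at the span renewal (S1); the SPAN twin of `kestenErickson_sandwich`.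
[cite: Erickson1973, Lemma 1; MadrasSlade1993, §4.2, eqs. (4.2.4)–(4.2.5)] -/
theorem spanErickson (A : ℕ) :
    (A : ℝ) + 1 ≤ spanMass d A * ∑ j ∈ range (A + 1), irrSpanTail d j ∧
      spanMass d A * ∑ j ∈ range (A + 1), irrSpanTail d j ≤ 2 * (A : ℝ) + 1 := by
  have hr : ∀ n, irrSpanTail d n = 1 - ∑ k ∈ range (n + 1), spanLaw d k := fun n => rfl
  obtain ⟨hu0, hf0, hren⟩ := spanRenewal (d := d)
  have hu := spanGF_nonneg (d := d)
  have hrnn := irrSpanTail_nonneg (d := d)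
  exact ⟨_root_.Literature.Probability.Process.Renewal.erickson_lower hr hu0 hf0 hren hu hrnn A,
    _root_.Literature.Probability.Process.Renewal.erickson_upper hr hu0 hf0 hren hu hrnn A⟩

/-! ### §7. (b) The door is a statement about Kesten's measure -/

/-- A one-step bridge has span `1`. [cite: MadrasSlade1993, Definition 1.2.4] -/
theorem apply_zero_eq_one_of_mem_bridges_one {ω : ℕ → Site d} (hω : ω ∈ bridges d 1) : ω 1 0 = 1 := by
  have h1 := one_le_apply_zero_of_mem_bridges hω le_rfl
  obtain ⟨hs, -⟩ := mem_bridges.1 hω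
  have h := abs_apply_le_of_adj (mem_saws.1 hs).1 (mem_saws.1 hs).2.2.1 1 le_rfl 0
  have := (abs_le.1 h).2
  push_cast at this
  omega

/-- Aperiodicity: `f_1 ≥ λ_1 μ^{-1} = b_1 μ^{-1} > 0` (every one-step bridge is irreducible of span `1`).
[cite: DuminilCopinHammond2013, §2.2; MadrasSlade1993, Theorem 4.2.2 (the condition `f₁ > 0`)] -/
theorem spanLaw_one_pos : 0 < spanLaw d 1 := by
  classical
  have hμ := connectiveConstant_pos d
  have h1 : irrBrSpan d 1 ((1 : ℕ) : ℤ) = bridges d 1 := by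
    ext ω
    rw [mem_irrBrSpan, irreducibleBridges_one]
    constructor
    · exact fun h => h.1
    · intro h; exact ⟨h, by exact_mod_cast apply_zero_eq_one_of_mem_bridges_one h⟩
  have hterm : 0 < ((irrBrSpan d 1 ((1 : ℕ) : ℤ)).card : ℝ) / connectiveConstant d ^ 1 := by
    rw [h1]
    have : (1 : ℝ) ≤ (bridges d 1).card := by exact_mod_cast one_le_bridgeCount (d := d) 1
    positivity
  unfold spanLaw
  refine lt_of_lt_of_le hterm ?_
  exact (summable_irrBrSpan_div_pow (d := d) 1).le_tsum 1 fun n _ => by positivity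

/-- **(b) THE DOOR IS A STATEMENT ABOUT KESTEN'S MEASURE**: `u_A → 0` (the span door of the lane's engine file
`SAWBridgeSpanDecayEngine.lean`) if and only if the span law of a Kesten-irreducible bridge has INFINITE MEAN,
`Σ_A A f_A = ∞` — the renewal theorem (Madras–Slade Theorem 4.2.2 (b), both recurrence cases, `Renewal.tendsto_of_summable_mul` /
`Renewal.tendsto_zero_of_not_summable_mul`) for the span renewal (S1)–(S2), aperiodic because `f_1 > 0`.
[cite: MadrasSlade1993, Theorem 4.2.2 (b) (p. 91) and Appendix B; Erickson1973, Lemma 1] -/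
theorem spanGF_tendsto_zero_iff :
    Tendsto (spanGF d) atTop (𝓝 0) ↔ ¬ Summable fun A : ℕ => (A : ℝ) * spanLaw d A := by
  obtain ⟨hu0, hf0, hren⟩ := spanRenewal (d := d)
  have hu := spanGF_nonneg (d := d)
  have hu1 : ∀ A, spanGF d A ≤ 1 := fun A => (spanGF_summable_le_one A).2
  obtain ⟨hf, hf1⟩ := spanLaw_hasSum (d := d)
  have hf1pos := spanLaw_one_pos (d := d)
  constructor
  · intro h0 hmean
    have h := _root_.Literature.Probability.Process.Renewal.tendsto_of_summable_mul hu0 hu hu1 hf hf0 hren hf1 hf1pos hmean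
    have heq := tendsto_nhds_unique h0 h
    -- the mean is positive, so its inverse is not `0`
    have hpos : 0 < ∑' k : ℕ, (k : ℝ) * spanLaw d k := by
      have : (1 : ℕ) * spanLaw d 1 ≤ ∑' k : ℕ, (k : ℝ) * spanLaw d k :=
        hmean.le_tsum 1 fun k _ => mul_nonneg (Nat.cast_nonneg k) (hf k)
      push_cast at this
      linarith
    exact (inv_pos.2 hpos).ne' heq.symm
  · intro hmean
    exact _root_.Literature.Probability.Process.Renewal.tendsto_zero_of_not_summable_mul hu0 hu hu1 hf hf0 hren hf1
      hf1pos hmean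

/-! ### §8. (d) A Cesàro rate for the bridge mass is a power-law lower bound on the truncated mean span -/

/-- **(d)** If `U^{sp}_A ≤ C (A+1)^{1−η}` then `m^{sp}_A ≥ (A+1)^η / C`: a Cesàro rate of span decay for the critical bridge
mass is, up to the factor `2` of (a), EQUIVALENT to «Kesten-irreducible bridges are tall on average,
`E_I[min(span, A+1)] ≥ (A+1)^η/C`». [cite: Erickson1973, Lemma 1; MadrasSlade1993, §4.2] -/
theorem meanSpan_of_cesaro {C η : ℝ} (hC : 0 < C)
    (h : ∀ A : ℕ, spanMass d A ≤ C * ((A : ℝ) + 1) ^ (1 - η)) (A : ℕ) :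
    ((A : ℝ) + 1) ^ η / C ≤ ∑ j ∈ range (A + 1), irrSpanTail d j := by
  have hA1 : (0 : ℝ) < (A : ℝ) + 1 := by positivity
  have hlow := (spanErickson (d := d) A).1
  have hU := h A
  have hU0 : 0 < spanMass d A := lt_of_lt_of_le one_pos (one_le_spanMass A)
  set m := ∑ j ∈ range (A + 1), irrSpanTail d j with hm
  have hm0 : 0 ≤ m := sum_nonneg fun j _ => irrSpanTail_nonneg j
  -- `(A+1) ≤ U m ≤ C (A+1)^{1-η} m`, and `(A+1) = (A+1)^{1-η} (A+1)^η`
  have h1 : ((A : ℝ) + 1) ≤ C * ((A : ℝ) + 1) ^ (1 - η) * m :=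
    hlow.trans (mul_le_mul_of_nonneg_right hU hm0)
  have hsplit : ((A : ℝ) + 1) = ((A : ℝ) + 1) ^ (1 - η) * ((A : ℝ) + 1) ^ η := by
    rw [← Real.rpow_add hA1]; norm_num
  have hpow0 : 0 < ((A : ℝ) + 1) ^ (1 - η) := Real.rpow_pos_of_pos hA1 _
  rw [div_le_iff₀ hC]
  have h2 : ((A : ℝ) + 1) ^ (1 - η) * ((A : ℝ) + 1) ^ η ≤ ((A : ℝ) + 1) ^ (1 - η) * (m * C) := by
    rw [← hsplit]; linarith
  exact le_of_mul_le_mul_left h2 hpow0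

/-! ### §9. From the truncated span generating functions `V_M(z_c;B)` to `u_B` and `U^{sp}_A` -/

/-- `V_M(z_c;A) → u_A` as `M → ∞` (the partial sums of a convergent non-negative series).
[cite: Hutchcroft2018HammersleyWelsh, Lemma 2.3; MadrasSlade1993, Corollary 3.1.8] -/
theorem tendsto_brGF_spanGF (A : ℕ) :
    Tendsto (fun M : ℕ => brGF d M (connectiveConstant d)⁻¹ (A : ℤ)) atTop (𝓝 (spanGF d A)) := by
  have h := (spanGF_summable_le_one (d := d) A).1.hasSum.tendsto_sum_nat
  have e : (fun M : ℕ => ∑ m ∈ range M, ((brSpan d m (A : ℤ)).card : ℝ) / connectiveConstant d ^ m) ∘ (fun M => M + 1) =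
      fun M : ℕ => brGF d M (connectiveConstant d)⁻¹ (A : ℤ) := by
    funext M
    simp only [Function.comp]
    exact sum_range_brSpan_div_pow M _
  rw [← e]
  exact h.comp (tendsto_add_atTop_nat 1)

/-- A uniform bound on the truncated Cesàro sums passes to the limit: `(∀ M, Σ_{B≤A} V_M(z_c;B) ≤ K) ⇒ U^{sp}_A ≤ K`.
[cite: Hutchcroft2018HammersleyWelsh, Lemma 2.3; Erickson1973, Lemma 1] -/
theorem spanMass_le_of_sum_brGF_le {A : ℕ} {K : ℝ}
    (h : ∀ M : ℕ, ∑ B ∈ range (A + 1), brGF d M (connectiveConstant d)⁻¹ (B : ℤ) ≤ K) : spanMass d A ≤ K := by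
  have ht : Tendsto (fun M : ℕ => ∑ B ∈ range (A + 1), brGF d M (connectiveConstant d)⁻¹ (B : ℤ)) atTop
      (𝓝 (spanMass d A)) := by
    unfold spanMass
    exact tendsto_finsetSum _ fun B _ => tendsto_brGF_spanGF B
  exact le_of_tendsto' ht h

/-- **(d′) The Cesàro door in the engine's vocabulary**: a CESÀRO span-decay rate for the truncated critical bridge generating
functions, `Σ_{B≤A} V_M(z_c;B) ≤ C (A+1)^{1−η}` uniformly in `M` (the hypothesis `BridgeSpanCesaroRate d C η` of the lane's Cesàro
engine, unfolded), forces Kesten-irreducible bridges to be tall on average: `E_I[min(span, A+1)] ≥ (A+1)^η / C`.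
[cite: Erickson1973, Lemma 1; Hutchcroft2018HammersleyWelsh, Lemma 2.3] -/
theorem meanSpan_of_cesaroRate {C η : ℝ} (hC : 0 < C)
    (h : ∀ A M : ℕ, ∑ B ∈ range (A + 1), brGF d M (connectiveConstant d)⁻¹ (B : ℤ) ≤ C * ((A : ℝ) + 1) ^ (1 - η))
    (A : ℕ) : ((A : ℝ) + 1) ^ η / C ≤ ∑ j ∈ range (A + 1), irrSpanTail d j :=
  meanSpan_of_cesaro hC (fun A' => spanMass_le_of_sum_brGF_le (h A')) A

end Literature.Probability.RandomPlanarGeometry.SAW.Zd
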